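import Summits.BirchSwinnertonDyer.Rank1Residual.GaloisImage.CongruenceVisibilityWitness
import HarnessLib

/-!
# Localisation of Kummer classes at a `K`-field: zero restriction ⟺ local divisibility, and its
# transport along a `p`-congruence (cell `b2b-bsdres`, team n1011, seat p05 GEN 12; row
# T-SHA81-DIM3 FILE 1; skeleton `cells/n1011/skel/T-SHA81-DIM3.md`)

HONEST FRAMING (cell `b2b-bsdres`, run/shared/lean/b2b/bsd-rank1-residual/, verbatim in every
file): the goal of the cell is to DELETE the COMBINATION-SHAPED residual classes of the
Birch–Swinnerton-Dyer formula for ALL analytic-rank `≤ 1` elliptic curves over `ℚ` — "full BSD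
formula for every rank `≤ 1` curve in class `C`" assembled STRICTLY from published theorems — so
that the rank-`≤ 1` remainder becomes exactly the CONSTRUCTION-SHAPED classes, which are TYPED
(missing-input `Prop`s), NOT attempted. This is not "finishing BSD". Team n1011 (N10 / N11):
research route on the CONSTRUCTION-SHAPED class X4; no claim beyond the stated classes; nothing is
booked; marks UNCHANGED. Theorems only: no definition, no named fact, no `sorry`. The theorems
below are TOOL theorems (any field `K` of characteristic `0`, any `K`-field `L`, any `n ≠ 0`);
they close nothing by themselves.

## What and why

Row T-SHA81-DIM3 certifies the INDEPENDENCE in `H¹(K, E[p])` of visible classes coming from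
several `p`-congruent partners `E'_i` WITHOUT knowing the congruences `θ_i : E'_i[p] ⥲ E[p]`
explicitly: the test is "does the class restrict to ZERO at an auxiliary place `v`?", and that
question is `θ_i`-free and decided by POINT DIVISIBILITY in `E'_i(K_v)`. This file supplies the
two bridges, both at the level of a general `K`-field `L` (later `L = K_v`):

* `res_h1Equiv_eq_zero_iff` — for a `Γ_K`-isomorphism `θ : E'[n] ⥲ E[n]` with transport
  `θ_* = h1Equiv θ` on `H¹(K, ·)`: **`res_L (θ_* c) = 0 ↔ res_L c = 0`** (cocycle transport, as
  the tree's `mem_unramifiedKer_iff_h1Equiv_mem`);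
* `exists_smul_eq_of_res_kummerMapTorsion_eq_zero` — the CONVERSE of p09's criterion (a)
  (`VisibleWitness.res_kummerMapTorsion_eq_zero_of_exists_smul_eq`): **if the Kummer class
  `κ(P)`, `P ∈ E(K)`, restricts to zero in `H¹(L, E[n])` then `P|_L ∈ n · E(L)`** (the restriction
  is the local Kummer class of a root `R` of `P`, tree `res_kummerClassTorsion`; it vanishes iff
  `R − T` is `Γ_L`-fixed for some `n`-torsion `T`, tree `localKummerClass_eq_zero_iff`; Galois
  descent `E(K̄_L)^{Γ_L} = E(L)`, tree `mem_range_toGeomPoints_iff`, gives the `L`-rational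
  `n`-th root); iff form `res_kummerMapTorsion_eq_zero_iff_exists_smul_eq`;
* the transported forms `res_h1Equiv_kummerMapTorsion_eq_zero_iff_exists_smul_eq` (for
  `θ_* κ'(P)`) and `res_h1Equiv_kummerMapTorsion_eq_zero_of_forall_exists_smul_eq` (subgroup form:
  if every point of a subgroup `H ≤ E'(K)` is `n`-divisible in `E'(L)`, every transported class of
  `H` restricts to zero at `L`), with `forall_mem_closure_exists_smul_eq` (generators suffice).

References (provenance; every input used below is a theorem of the tree): [SilvermanAEC2009]
VIII.§2 (Kummer pairing, exactness at `E(K)/mE(K)`), X.§4 diagram (**) (compatibility of the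
global and local Kummer sequences); [CremonaMazur2000] §3; [AgasheStein2002] §3.
-/

noncomputable section

open scoped Classical

universe u

namespace Summit.BirchSwinnertonDyer.Rank1Residual.GaloisImage.VisibleIndependence

open WeierstrassCurve Literature.NumberTheory.EllipticCurves Literature.NumberTheory.GaloisRepresentations
open Field NumberField IsDedekindDomain
open Summit.BirchSwinnertonDyer.Rank1Residual.GaloisImage.VisibleWitness

/-! ## §1 Zero restriction is transported along `θ` -/

section Transport

variable {K : Type u} [Field K] (W W' : WeierstrassCurve K) {n : ℤ}
  (θ : geomTorsion W' n ≃+ geomTorsion W n)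
  (hθ : ∀ (σ : absoluteGaloisGroup K) (P : geomTorsion W' n), θ (σ • P) = σ • θ P)
  (L : Type u) [Field L] [Algebra K L]

/-- **Zero restriction is transported along a `Γ_K`-isomorphism `θ : E'[n] ⥲ E[n]`.** For a class
`c ∈ H¹(K, E'[n])` and a `K`-field `L`: `res_L (θ_* c) = 0 ↔ res_L c = 0` (`θ_* = h1Equiv θ`).
On cocycles: `res_L [φ] = [φ ∘ res]` (`res_torsionGaloisModule_oneCocycleClass`), `θ_* [φ] = [θ ∘ φ]`
(`h1Equiv_oneCocycleClass`), and `φ ∘ res` is the coboundary of `a` iff `θ ∘ φ ∘ res` is the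
coboundary of `θ a` (`hθ`). [folklore] -/
theorem res_h1Equiv_eq_zero_iff (c : galH1Torsion W' n) :
    galoisCohomology.res (W.torsionGaloisModule n) L 1 (h1Equiv θ hθ c) = 0 ↔
      galoisCohomology.res (W'.torsionGaloisModule n) L 1 c = 0 := by
  obtain ⟨φ, rfl⟩ :=
    oneCocycleClass_surjective (discreteTopRep (absoluteGaloisGroup K) (geomTorsion W' n)) c
  rw [h1Equiv_oneCocycleClass, res_torsionGaloisModule_oneCocycleClass,
    res_torsionGaloisModule_oneCocycleClass]
  constructor
  · intro h
    obtain ⟨b, hb⟩ := (oneCocycleClass_eq_zero_iff _ _).mp h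
    refine (oneCocycleClass_eq_zero_iff _ _).mpr ⟨θ.symm b, fun σ ↦ θ.injective ?_⟩
    have h1 : θ (φ.1 (resGal (K := K) L σ)) = resGal (K := K) L σ • b - b := hb σ
    change θ (φ.1 (resGal (K := K) L σ)) = θ (resGal (K := K) L σ • θ.symm b - θ.symm b)
    rw [map_sub, hθ, AddEquiv.apply_symm_apply, h1]
  · intro h
    obtain ⟨a, ha⟩ := (oneCocycleClass_eq_zero_iff _ _).mp h
    refine (oneCocycleClass_eq_zero_iff _ _).mpr ⟨θ a, fun σ ↦ ?_⟩
    have h1 : φ.1 (resGal (K := K) L σ) = resGal (K := K) L σ • a - a := ha σ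
    change θ (φ.1 (resGal (K := K) L σ)) = resGal (K := K) L σ • θ a - θ a
    rw [h1, map_sub, hθ]

end Transport

/-! ## §2 Zero restriction of a Kummer class ⟺ local divisibility of the point -/

section Localisation

variable {K : Type u} [Field K] [CharZero K] (W : WeierstrassCurve K) [W.IsElliptic] {n : ℤ}
  (L : Type u) [Field L] [Algebra K L]

/-- **The converse of criterion (a): zero restriction forces local divisibility.** For `P ∈ E(K)`
with Kummer class `κ(P) ∈ H¹(K, E[n])` (`kummerMapTorsion`, any admissible choice of roots `hdiv`)
and a `K`-field `L`: if `res_L κ(P) = 0` then `P|_L = n • Q` for some `L`-rational point `Q` of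
`W⁄L`. Proof: with a root `R ∈ E(K̄)` of `P` (`zsmulRoot`), `res_L κ(P)` is the local Kummer class of
`R` read in `E(K̄_L)` (`res_kummerClassTorsion`); it vanishes iff `R − T` is `Γ_L`-fixed for some
`T ∈ E(K̄_L)[n]` (`localKummerClass_eq_zero_iff`); `Q := R − T` descends to `(W⁄L)(L)` (Galois
descent over the perfect field `L`, `mem_range_toGeomPoints_iff`), and `n • Q = n • R = P|_L`.
Silverman, *AEC*, X.§4 (exactness of the local Kummer sequence at `E(K_v)/mE(K_v)` and
commutativity of (**)). [folklore] -/
theorem exists_smul_eq_of_res_kummerMapTorsion_eq_zero [CharZero L] (hn : n ≠ 0)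
    (hdiv : ∀ P : geomPoints W, ∃ Q : geomPoints W, n • Q = P) (P : W.toAffine.Point)
    (h : galoisCohomology.res (W.torsionGaloisModule n) L 1 (kummerMapTorsion W n hdiv P) = 0) :
    ∃ Q : (W.baseChange L).toAffine.Point,
      n • Q = WeierstrassCurve.Affine.Point.baseChange (W' := W) K L P := by
  have hR : n • zsmulRoot W n hdiv P = toGeomPoints W P := zsmul_zsmulRoot W n hdiv P
  rw [kummerMapTorsion_apply, kummerMapTorsionFun,
    res_kummerClassTorsion W n hn (zsmulRoot W n hdiv P) (zsmul_zsmulRoot_mem W n hdiv P)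
      (zsmul_pointsMap_mem_fixedPoints W n _ (zsmul_zsmulRoot_mem W n hdiv P)),
    localKummerClass_eq_zero_iff] at h
  obtain ⟨T, hT, hfix⟩ := h
  -- `Q̃ := R|_{K̄_L} − T` is `Γ_L`-fixed: descend it to an `L`-rational point of `W⁄L`
  have hfix' : (W.baseChangeGeomPointsEquiv L).symm (pointsMap W L (zsmulRoot W n hdiv P) - T) ∈
      MulAction.fixedPoints (absoluteGaloisGroup L) (geomPoints (W.baseChange L)) := fun σ ↦ by
    rw [← baseChangeGeomPointsEquiv_symm_smul, hfix σ]
  obtain ⟨Q, hQ⟩ := (mem_range_toGeomPoints_iff (W.baseChange L) _).mpr hfix'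
  refine ⟨Q, toGeomPoints_injective (W.baseChange L)
    ((W.baseChangeGeomPointsEquiv L).injective ?_)⟩
  have hT0 : n • T = 0 := hT
  rw [map_zsmul, map_zsmul, hQ, AddEquiv.apply_symm_apply, zsmul_sub, ← map_zsmul, hR,
    pointsMap_toGeomPoints_eq, hT0, sub_zero]

/-- **Zero restriction ⟺ local divisibility**: `res_L κ(P) = 0 ↔ ∃ Q ∈ (W⁄L)(L), n • Q = P|_L`
(`⇐` is p09's criterion (a) `VisibleWitness.res_kummerMapTorsion_eq_zero_of_exists_smul_eq`).
Silverman, *AEC*, X.§4. [folklore] -/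
theorem res_kummerMapTorsion_eq_zero_iff_exists_smul_eq [CharZero L] (hn : n ≠ 0)
    (hdiv : ∀ P : geomPoints W, ∃ Q : geomPoints W, n • Q = P) (P : W.toAffine.Point) :
    galoisCohomology.res (W.torsionGaloisModule n) L 1 (kummerMapTorsion W n hdiv P) = 0 ↔
      ∃ Q : (W.baseChange L).toAffine.Point,
        n • Q = WeierstrassCurve.Affine.Point.baseChange (W' := W) K L P :=
  ⟨exists_smul_eq_of_res_kummerMapTorsion_eq_zero W L hn hdiv P,
    res_kummerMapTorsion_eq_zero_of_exists_smul_eq W L hn hdiv P⟩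

end Localisation

/-! ## §3 The transported class `θ_* κ'(P)` -/

section Transported

variable {K : Type u} [Field K] [CharZero K] (W W' : WeierstrassCurve K) [W'.IsElliptic] {n : ℤ}
  (θ : geomTorsion W' n ≃+ geomTorsion W n)
  (hθ : ∀ (σ : absoluteGaloisGroup K) (P : geomTorsion W' n), θ (σ • P) = σ • θ P)
  (L : Type u) [Field L] [Algebra K L]

/-- **The transported Kummer class `θ_* κ'(P)` of `P ∈ E'(K)` restricts to zero at `L` iff `P|_L`
is `n`-divisible in `E'(L)`** — a condition in which `θ` does NOT appear. [folklore] -/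
theorem res_h1Equiv_kummerMapTorsion_eq_zero_iff_exists_smul_eq [CharZero L] (hn : n ≠ 0)
    (hdiv' : ∀ P : geomPoints W', ∃ Q : geomPoints W', n • Q = P) (P : W'.toAffine.Point) :
    galoisCohomology.res (W.torsionGaloisModule n) L 1
        (h1Equiv θ hθ (kummerMapTorsion W' n hdiv' P)) = 0 ↔
      ∃ Q : (W'.baseChange L).toAffine.Point,
        n • Q = WeierstrassCurve.Affine.Point.baseChange (W' := W') K L P := by
  rw [res_h1Equiv_eq_zero_iff W W' θ hθ L,
    res_kummerMapTorsion_eq_zero_iff_exists_smul_eq W' L hn hdiv' P]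

/-- **Subgroup form (the hypothesis `(V)` of the row).** If every point of a subgroup
`H ≤ E'(K)` becomes `n`-divisible in `E'(L)`, then the transported Kummer class of every point of
`H` restricts to zero at `L`. (It suffices to check generators of `H`: the locally `n`-divisible
points form a subgroup, the preimage of `n · E'(L)`.) [folklore] -/
theorem res_h1Equiv_kummerMapTorsion_eq_zero_of_forall_exists_smul_eq [CharZero L]
    (hn : n ≠ 0) (hdiv' : ∀ P : geomPoints W', ∃ Q : geomPoints W', n • Q = P)
    (H : AddSubgroup W'.toAffine.Point)
    (hH : ∀ P ∈ H, ∃ Q : (W'.baseChange L).toAffine.Point,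
      n • Q = WeierstrassCurve.Affine.Point.baseChange (W' := W') K L P)
    {P : W'.toAffine.Point} (hP : P ∈ H) :
    galoisCohomology.res (W.torsionGaloisModule n) L 1
        (h1Equiv θ hθ (kummerMapTorsion W' n hdiv' P)) = 0 :=
  (res_h1Equiv_kummerMapTorsion_eq_zero_iff_exists_smul_eq W W' θ hθ L hn hdiv' P).mpr (hH P hP)

omit [CharZero K] [W'.IsElliptic] in
/-- **Generators suffice for `(V)`.** The points of `E'(K)` that become `n`-divisible in `E'(L)`
form a subgroup (the preimage of the range of multiplication by `n` on `(W'⁄L)(L)` under base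
change); hence if a set `s` of points is locally `n`-divisible at `L`, so is every point of the
subgroup it generates. [folklore] -/
theorem forall_mem_closure_exists_smul_eq (s : Set W'.toAffine.Point)
    (hs : ∀ P ∈ s, ∃ Q : (W'.baseChange L).toAffine.Point,
      n • Q = WeierstrassCurve.Affine.Point.baseChange (W' := W') K L P) :
    ∀ P ∈ AddSubgroup.closure s, ∃ Q : (W'.baseChange L).toAffine.Point,
      n • Q = WeierstrassCurve.Affine.Point.baseChange (W' := W') K L P := by
  intro P hP
  induction hP using AddSubgroup.closure_induction with
  | mem x hx => exact hs x hx
  | zero => exact ⟨0, by rw [zsmul_zero]; exact (map_zero _).symm⟩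
  | add x y _ _ hx hy =>
    obtain ⟨Qx, hQx⟩ := hx
    obtain ⟨Qy, hQy⟩ := hy
    exact ⟨Qx + Qy, by rw [zsmul_add, hQx, hQy]; exact (map_add _ x y).symm⟩
  | neg x _ hx =>
    obtain ⟨Qx, hQx⟩ := hx
    exact ⟨-Qx, by rw [zsmul_neg, hQx]; exact (map_neg _ x).symm⟩

end Transported

end Summit.BirchSwinnertonDyer.Rank1Residual.GaloisImage.VisibleIndependence

end
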